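import Summits.HodgeConjecture.HodgeConjecture.Theorems.Ring2WeilCoverageNormClassEq
import Summits.HodgeConjecture.HodgeConjecture.Theorems.Ring2WeilCoverageNormTableC
import HarnessLib

/-!
# Weil-type family coverage — product windows, part N: THE PILLOWCASE WINDOW on the remaining rows of the sixfold tables
# (`ℚ(√-3)`: `a = 34, 46, 55, 85, 115, 187`; `ℚ(i)`: `a = 57, 69, 77, 133, 161`)

research route conditional on HC_CM; not a corollary; Q11.4-sentence-2 already refuted in dim ≥ 3.

Ring 2, WEIL-TYPE FAMILY-COVERAGE CENSUS (`HOME/WEIL-FAMILY-COVERAGE.md` `## b04`, block b04.15, owner ring2-b04, gen 51); fourteenth part of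
`Ring2WeilCoverageProductWindow` (companion of parts L / M, same conventions; engine `polyrun.py` + `bigwin.py` on kit jobs j204903,
j204905–j204907, j204909–j204912; mirror `HOME/pub-hodge-ring2-b04/census-g51/`).  The UNIFORM FAMILIES of THEOREM S10 evaluated on the
`|T| = 2` rows of ring2-b02's sixfold tables (§b02.3) that no window had reached: for `K = ℚ(√-3)` the type-`(3,3,3,0)` lattice 9-gons
`turns (-1,-1,-1,+2,+1,+1,+1,+2,+2)`, `sides (1,1,1,L,1,L,2,3,2)`, `n = 9 + 2L` (odd) / `turns (-1,-1,-1,+1,+2,+1,+1,+2,+2)`, `sides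
(1,1,1,L,1,L+1,2,3,2)`, `n = 10 + 2L` (even), passports `(4.3^{(n-7)/3…}…)` as printed per theorem, `Y_P : y³ = φ_P(φ_P − 1)` of genus 7 on `3n`
sheets; for `K = ℚ(i)` the `B₂` wall 9-gons `turns (-2,+1,+3,-2,+2,+2,-1,+2,+3)`, `sides (1,1,1,1,1+L,1,1+L,1,1)`, `n = 7 + 2L`, `Y_P : y⁴ =
φ_P(φ_P − 1)` of genus 8 on `4n` sheets.  Every hidden factor `B = P(Y_P/E)_λ` is a `(3,3)` WEIL-TYPE sixfold with literal `det H = -192/n`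
(`ℚ(√-3)`, odd `n`), `-96/n·…` (even `n`), `-2/n` (`ℚ(i)`), class `[n]` as THEOREM S8 predicts; monodromy of `φ_P` = `A_n` / `S_n` (certified
lower bounds in the engine records).  With parts L / M: EVERY row of both sixfold tables of §b02.3 (`K = ℚ(√-3)`, `ℚ(i)`; `a ≤ 187` resp.
`≤ 161`; `a = 253, 391` resp. `209, 253, 437` running as kit j204908 / j205483 / j204913 / j205487 / j205494) now has an explicit
curve-carried `(3,3)` member.  §0: the four single-prime descents `46, 115 ∉ Nm(ℚ(√-3)ˣ)`, `69, 161 ∉ Nm(ℚ(i)ˣ)` (inert prime `23`) used as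
row keys.

No `def`, no named fact, no `sorry`; nothing here is a statement about Hodge classes; `HC_CM` is used nowhere.
References: [cite: vanGeemen1994HodgeAV, (5.4.1), Lemma 5.2]; [cite: Serre1973, Ch. III §1].
-/

set_option linter.dupNamespace false

open Literature.AlgebraicGeometry.Motives
open Literature.AlgebraicGeometry.VanGeemen1994
open Summit.HodgeConjecture.HodgeConjecture.Ring2.Hypotheses

namespace Summit.HodgeConjecture.HodgeConjecture.Ring2.WeilCoverage

/-! ### §0 Row keys at the inert prime 23 -/

namespace SqrtNeg3

/-- `46 ∉ Nm(ℚ(√-3)ˣ)`: descent at the inert prime `23` (`-3` is a non-square mod `23`, `23 ∥ 46`). research route conditional on HC_CM; not a corollary; Q11.4-sentence-2 already refuted in dim ≥ 3. [cite: Serre1973, Ch. III §1] -/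
theorem not_mem_46 : Units.mk0 (46 : ℚ) (by norm_num) ∉ normUnitsSubgroup ℚ (weilField 3) := by
  simpa using natCast_not_mem_normUnitsSubgroup_of_inert (d := 3) (a := 46) (p := 23)
    (by norm_num) (by decide) (by norm_num) (by norm_num) (by norm_num)

/-- `115 ∉ Nm(ℚ(√-3)ˣ)`: descent at the inert prime `23` (`-3` is a non-square mod `23`, `23 ∥ 115`). research route conditional on HC_CM; not a corollary; Q11.4-sentence-2 already refuted in dim ≥ 3. [cite: Serre1973, Ch. III §1] -/
theorem not_mem_115 : Units.mk0 (115 : ℚ) (by norm_num) ∉ normUnitsSubgroup ℚ (weilField 3) := by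
  simpa using natCast_not_mem_normUnitsSubgroup_of_inert (d := 3) (a := 115) (p := 23)
    (by norm_num) (by decide) (by norm_num) (by norm_num) (by norm_num)

end SqrtNeg3

namespace SqrtNeg1

/-- `69 ∉ Nm(ℚ(√-1)ˣ)`: descent at the inert prime `23` (`-1` is a non-square mod `23`, `23 ∥ 69`). research route conditional on HC_CM; not a corollary; Q11.4-sentence-2 already refuted in dim ≥ 3. [cite: Serre1973, Ch. III §1] -/
theorem not_mem_69 : Units.mk0 (69 : ℚ) (by norm_num) ∉ normUnitsSubgroup ℚ (weilField 1) := by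
  simpa using natCast_not_mem_normUnitsSubgroup_of_inert (d := 1) (a := 69) (p := 23)
    (by norm_num) (by decide) (by norm_num) (by norm_num) (by norm_num)

/-- `161 ∉ Nm(ℚ(√-1)ˣ)`: descent at the inert prime `23` (`-1` is a non-square mod `23`, `23 ∥ 161`). research route conditional on HC_CM; not a corollary; Q11.4-sentence-2 already refuted in dim ≥ 3. [cite: Serre1973, Ch. III §1] -/
theorem not_mem_161 : Units.mk0 (161 : ℚ) (by norm_num) ∉ normUnitsSubgroup ℚ (weilField 1) := by
  simpa using natCast_not_mem_normUnitsSubgroup_of_inert (d := 1) (a := 161) (p := 23)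
    (by norm_num) (by decide) (by norm_num) (by norm_num) (by norm_num)

end SqrtNeg1

/-! ### §1 `K = ℚ(√-3)`: `n = 34, 46, 55, 85, 115, 187` -/

/-- PILLOWCASE datum (A₂ alcove lattice, orbifold `ℙ¹(3,3,3) = E_ω/C₃`): the double of the lattice 9-gon `P` with turning sequence `-1,-1,-1,+1,+2,+1,+1,+2,+2` (×60°) and side lengths `1,1,1,12,1,13,2,3,2` is a Belyi map `φ_P : ℙ¹ → ℙ¹` of degree `n = 34` (= number of alcoves of `P`) with passport `(4.3^9.2.1, 4^2.3^7.2^2.1, 3^11.1)` and monodromy group `A34` (certified: randomized Schreier–Sims lower bound = the full order); `Y_P : y³ = φ_P(φ_P − 1)` (genus 7) is the normalised fibre product `E ×_{ℙ¹} ℙ¹_{φ_P}` (102 sheets over `ℙ¹`; engine `bigwin.py`, exact) and the HIDDEN FACTOR `B` = the `λ`-part of the Prym `P(Y_P/E)` — an abelian SIXFOLD with `(3,3)` `ℚ(√-3)`-action, WEIL TYPE — has literal `det H|_B = -96/17`, `a = 96/17`, `T(a) = [2, 17]`: row `W6.3.34` (NON-split); `r₁ = dim_K H¹(D)_λ = 1`,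 `r_H = 7`. THEOREM S8 (Prym form of the product-window law, census b04.15 (A): `[a_B] = [n]^{r₁}`, no 2-transitivity needed) predicts `T(a_B) = [2, 17]` from `r₁ = 1`, `n = 34` — CONFIRMED.
research route conditional on HC_CM; not a corollary; Q11.4-sentence-2 already refuted in dim ≥ 3. [cite: vanGeemen1994HodgeAV, (5.4.1)] -/
theorem pillow3_C3A34_n34_f21fe8_mk_detH_ne_split :
    (QuotientGroup.mk (Units.mk0 (((-96 : ℚ) / 17)) (by norm_num)) : weilNormResidueGroup 3) ≠
      splitDiscriminantClass 3 3 := by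
  have e : Units.mk0 (((-96 : ℚ) / 17)) (by norm_num) = -(Units.mk0 ((96 : ℚ) / 17) (by norm_num)) := Units.ext (by norm_num)
  rw [Ne, e, mk_neg_eq_splitDiscriminantClass_iff_of_odd (n := 3) (by decide)]
  have h := mul_not_mem_normUnitsSubgroup (mem_normUnitsSubgroup_of_sq_add_mul_sq (d := 3) (a := ((48 : ℚ) / 289)) (by norm_num) (0 : ℚ) ((4 : ℚ) / 17) (by norm_num))
    Summit.HodgeConjecture.HodgeConjecture.Ring2.WeilCoverage.SqrtNeg3.not_mem_34
  rw [mk0_mul_mk0] at h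
  norm_num at h
  exact h

/-- The same datum, CELL IDENTIFICATION: `[det H|_B] = [-34]` in `ℚˣ/Nm(ℚ(√-3)ˣ)` — the census ROW KEY of `W6.3.34` (`a·34 = (192 : ℚ) = ((0 : ℚ))² + 3·((8 : ℚ))²`).
research route conditional on HC_CM; not a corollary; Q11.4-sentence-2 already refuted in dim ≥ 3. [cite: vanGeemen1994HodgeAV, Lemma 5.2 (3)] -/
theorem pillow3_C3A34_n34_f21fe8_mk_detH_eq_key :
    (QuotientGroup.mk (Units.mk0 (-(((96 : ℚ) / 17))) (neg_ne_zero.2 (by norm_num))) : weilNormResidueGroup 3) =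
      QuotientGroup.mk (Units.mk0 (-(34 : ℚ)) (neg_ne_zero.2 (by norm_num))) :=
  mk_neg_eq_mk_neg_of_mul_mem (by norm_num) (by norm_num)
    (mem_normUnitsSubgroup_of_sq_add_mul_sq _ (0 : ℚ) (8 : ℚ) (by norm_num))

/-- PILLOWCASE datum (A₂ alcove lattice, orbifold `ℙ¹(3,3,3) = E_ω/C₃`): the double of the lattice 9-gon `P` with turning sequence `-1,-1,-1,+1,+2,+1,+1,+2,+2` (×60°) and side lengths `1,1,1,18,1,19,2,3,2` is a Belyi map `φ_P : ℙ¹ → ℙ¹` of degree `n = 46` (= number of alcoves of `P`) with passport `(4.3^13.2.1, 4^2.3^11.2^2.1, 3^15.1)` and monodromy group `A46` (certified: randomized Schreier–Sims lower bound = the full order); `Y_P : y³ = φ_P(φ_P − 1)` (genus 7) is the normalised fibre product `E ×_{ℙ¹} ℙ¹_{φ_P}` (138 sheets over `ℙ¹`; engine `bigwin.py`, exact) and the HIDDEN FACTOR `B` = the `λ`-part of the Prym `P(Y_P/E)` — an abelian SIXFOLD with `(3,3)` `ℚ(√-3)`-action, WEIL TYPE — has literal `det H|_B = -96/23`, `a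 = 96/23`, `T(a) = [2, 23]`: row `W6.3.46` (NON-split); `r₁ = dim_K H¹(D)_λ = 1`, `r_H = 7`. THEOREM S8 (Prym form of the product-window law, census b04.15 (A): `[a_B] = [n]^{r₁}`, no 2-transitivity needed) predicts `T(a_B) = [2, 23]` from `r₁ = 1`, `n = 46` — CONFIRMED.
research route conditional on HC_CM; not a corollary; Q11.4-sentence-2 already refuted in dim ≥ 3. [cite: vanGeemen1994HodgeAV, (5.4.1)] -/
theorem pillow3_C3A46_n46_ee5243_mk_detH_ne_split :
    (QuotientGroup.mk (Units.mk0 (((-96 : ℚ) / 23)) (by norm_num)) : weilNormResidueGroup 3) ≠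
      splitDiscriminantClass 3 3 := by
  have e : Units.mk0 (((-96 : ℚ) / 23)) (by norm_num) = -(Units.mk0 ((96 : ℚ) / 23) (by norm_num)) := Units.ext (by norm_num)
  rw [Ne, e, mk_neg_eq_splitDiscriminantClass_iff_of_odd (n := 3) (by decide)]
  have h := mul_not_mem_normUnitsSubgroup (mem_normUnitsSubgroup_of_sq_add_mul_sq (d := 3) (a := ((48 : ℚ) / 529)) (by norm_num) (0 : ℚ) ((4 : ℚ) / 23) (by norm_num))
    SqrtNeg3.not_mem_46
  rw [mk0_mul_mk0] at h
  norm_num at h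
  exact h

/-- The same datum, CELL IDENTIFICATION: `[det H|_B] = [-46]` in `ℚˣ/Nm(ℚ(√-3)ˣ)` — the census ROW KEY of `W6.3.46` (`a·46 = (192 : ℚ) = ((0 : ℚ))² + 3·((8 : ℚ))²`).
research route conditional on HC_CM; not a corollary; Q11.4-sentence-2 already refuted in dim ≥ 3. [cite: vanGeemen1994HodgeAV, Lemma 5.2 (3)] -/
theorem pillow3_C3A46_n46_ee5243_mk_detH_eq_key :
    (QuotientGroup.mk (Units.mk0 (-(((96 : ℚ) / 23))) (neg_ne_zero.2 (by norm_num))) : weilNormResidueGroup 3) =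
      QuotientGroup.mk (Units.mk0 (-(46 : ℚ)) (neg_ne_zero.2 (by norm_num))) :=
  mk_neg_eq_mk_neg_of_mul_mem (by norm_num) (by norm_num)
    (mem_normUnitsSubgroup_of_sq_add_mul_sq _ (0 : ℚ) (8 : ℚ) (by norm_num))

/-- PILLOWCASE datum (A₂ alcove lattice, orbifold `ℙ¹(3,3,3) = E_ω/C₃`): the double of the lattice 9-gon `P` with turning sequence `-1,-1,-1,+2,+1,+1,+1,+2,+2` (×60°) and side lengths `1,1,1,23,1,23,2,3,2` is a Belyi map `φ_P : ℙ¹ → ℙ¹` of degree `n = 55` (= number of alcoves of `P`) with passport `(4.3^16.2.1, 4^2.3^14.2^2.1, 3^18.1)` and monodromy group `A55` (certified: randomized Schreier–Sims lower bound = the full order); `Y_P : y³ = φ_P(φ_P − 1)` (genus 7) is the normalised fibre product `E ×_{ℙ¹} ℙ¹_{φ_P}` (165 sheets over `ℙ¹`; engine `bigwin.py`, exact) and the HIDDEN FACTOR `B` = the `λ`-part of the Prym `P(Y_P/E)` — an abelian SIXFOLD with `(3,3)` `ℚ(√-3)`-action, WEIL TYPE — has literal `det H|_B = -192/55`, `a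 = 192/55`, `T(a) = [5, 11]`: row `W6.3.55` (NON-split); `r₁ = dim_K H¹(D)_λ = 1`, `r_H = 7`. THEOREM S8 (Prym form of the product-window law, census b04.15 (A): `[a_B] = [n]^{r₁}`, no 2-transitivity needed) predicts `T(a_B) = [5, 11]` from `r₁ = 1`, `n = 55` — CONFIRMED.
research route conditional on HC_CM; not a corollary; Q11.4-sentence-2 already refuted in dim ≥ 3. [cite: vanGeemen1994HodgeAV, (5.4.1)] -/
theorem pillow3_C3A55_n55_e690ac_mk_detH_ne_split :
    (QuotientGroup.mk (Units.mk0 (((-192 : ℚ) / 55)) (by norm_num)) : weilNormResidueGroup 3) ≠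
      splitDiscriminantClass 3 3 := by
  have e : Units.mk0 (((-192 : ℚ) / 55)) (by norm_num) = -(Units.mk0 ((192 : ℚ) / 55) (by norm_num)) := Units.ext (by norm_num)
  rw [Ne, e, mk_neg_eq_splitDiscriminantClass_iff_of_odd (n := 3) (by decide)]
  have h := mul_not_mem_normUnitsSubgroup (mem_normUnitsSubgroup_of_sq_add_mul_sq (d := 3) (a := ((192 : ℚ) / 3025)) (by norm_num) (0 : ℚ) ((8 : ℚ) / 55) (by norm_num))
    Summit.HodgeConjecture.HodgeConjecture.Ring2.WeilCoverage.SqrtNeg3.not_mem_55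
  rw [mk0_mul_mk0] at h
  norm_num at h
  exact h

/-- The same datum, CELL IDENTIFICATION: `[det H|_B] = [-55]` in `ℚˣ/Nm(ℚ(√-3)ˣ)` — the census ROW KEY of `W6.3.55` (`a·55 = (192 : ℚ) = ((0 : ℚ))² + 3·((8 : ℚ))²`).
research route conditional on HC_CM; not a corollary; Q11.4-sentence-2 already refuted in dim ≥ 3. [cite: vanGeemen1994HodgeAV, Lemma 5.2 (3)] -/
theorem pillow3_C3A55_n55_e690ac_mk_detH_eq_key :
    (QuotientGroup.mk (Units.mk0 (-(((192 : ℚ) / 55))) (neg_ne_zero.2 (by norm_num))) : weilNormResidueGroup 3) =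
      QuotientGroup.mk (Units.mk0 (-(55 : ℚ)) (neg_ne_zero.2 (by norm_num))) :=
  mk_neg_eq_mk_neg_of_mul_mem (by norm_num) (by norm_num)
    (mem_normUnitsSubgroup_of_sq_add_mul_sq _ (0 : ℚ) (8 : ℚ) (by norm_num))

/-- PILLOWCASE datum (A₂ alcove lattice, orbifold `ℙ¹(3,3,3) = E_ω/C₃`): the double of the lattice 9-gon `P` with turning sequence `-1,-1,-1,+2,+1,+1,+1,+2,+2` (×60°) and side lengths `1,1,1,38,1,38,2,3,2` is a Belyi map `φ_P : ℙ¹ → ℙ¹` of degree `n = 85` (= number of alcoves of `P`) with passport `(4.3^26.2.1, 4^2.3^24.2^2.1, 3^28.1)` and monodromy group `A85` (certified: randomized Schreier–Sims lower bound = the full order); `Y_P : y³ = φ_P(φ_P − 1)` (genus 7) is the normalised fibre product `E ×_{ℙ¹} ℙ¹_{φ_P}` (255 sheets over `ℙ¹`; engine `bigwin.py`, exact) and the HIDDEN FACTOR `B` = the `λ`-part of the Prym `P(Y_P/E)` — an abelian SIXFOLD with `(3,3)` `ℚ(√-3)`-action, WEIL TYPE — has literal `det H|_B = -192/85`, `a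 = 192/85`, `T(a) = [5, 17]`: row `W6.3.85` (NON-split); `r₁ = dim_K H¹(D)_λ = 1`, `r_H = 7`. THEOREM S8 (Prym form of the product-window law, census b04.15 (A): `[a_B] = [n]^{r₁}`, no 2-transitivity needed) predicts `T(a_B) = [5, 17]` from `r₁ = 1`, `n = 85` — CONFIRMED.
research route conditional on HC_CM; not a corollary; Q11.4-sentence-2 already refuted in dim ≥ 3. [cite: vanGeemen1994HodgeAV, (5.4.1)] -/
theorem pillow3_C3A85_n85_f57e65_mk_detH_ne_split :
    (QuotientGroup.mk (Units.mk0 (((-192 : ℚ) / 85)) (by norm_num)) : weilNormResidueGroup 3) ≠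
      splitDiscriminantClass 3 3 := by
  have e : Units.mk0 (((-192 : ℚ) / 85)) (by norm_num) = -(Units.mk0 ((192 : ℚ) / 85) (by norm_num)) := Units.ext (by norm_num)
  rw [Ne, e, mk_neg_eq_splitDiscriminantClass_iff_of_odd (n := 3) (by decide)]
  have h := mul_not_mem_normUnitsSubgroup (mem_normUnitsSubgroup_of_sq_add_mul_sq (d := 3) (a := ((192 : ℚ) / 7225)) (by norm_num) (0 : ℚ) ((8 : ℚ) / 85) (by norm_num))
    Summit.HodgeConjecture.HodgeConjecture.Ring2.WeilCoverage.SqrtNeg3.not_mem_85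
  rw [mk0_mul_mk0] at h
  norm_num at h
  exact h

/-- The same datum, CELL IDENTIFICATION: `[det H|_B] = [-85]` in `ℚˣ/Nm(ℚ(√-3)ˣ)` — the census ROW KEY of `W6.3.85` (`a·85 = (192 : ℚ) = ((0 : ℚ))² + 3·((8 : ℚ))²`).
research route conditional on HC_CM; not a corollary; Q11.4-sentence-2 already refuted in dim ≥ 3. [cite: vanGeemen1994HodgeAV, Lemma 5.2 (3)] -/
theorem pillow3_C3A85_n85_f57e65_mk_detH_eq_key :
    (QuotientGroup.mk (Units.mk0 (-(((192 : ℚ) / 85))) (neg_ne_zero.2 (by norm_num))) : weilNormResidueGroup 3) =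
      QuotientGroup.mk (Units.mk0 (-(85 : ℚ)) (neg_ne_zero.2 (by norm_num))) :=
  mk_neg_eq_mk_neg_of_mul_mem (by norm_num) (by norm_num)
    (mem_normUnitsSubgroup_of_sq_add_mul_sq _ (0 : ℚ) (8 : ℚ) (by norm_num))

/-- PILLOWCASE datum (A₂ alcove lattice, orbifold `ℙ¹(3,3,3) = E_ω/C₃`): the double of the lattice 9-gon `P` with turning sequence `-1,-1,-1,+2,+1,+1,+1,+2,+2` (×60°) and side lengths `1,1,1,53,1,53,2,3,2` is a Belyi map `φ_P : ℙ¹ → ℙ¹` of degree `n = 115` (= number of alcoves of `P`) with passport `(4.3^36.2.1, 4^2.3^34.2^2.1, 3^38.1)` and monodromy group `A115` (certified: randomized Schreier–Sims lower bound = the full order); `Y_P : y³ = φ_P(φ_P − 1)` (genus 7) is the normalised fibre product `E ×_{ℙ¹} ℙ¹_{φ_P}` (345 sheets over `ℙ¹`; engine `bigwin.py`, exact) and the HIDDEN FACTOR `B` = the `λ`-part of the Prym `P(Y_P/E)` — an abelian SIXFOLD with `(3,3)` `ℚ(√-3)`-action, WEIL TYPE — has literal `det H|_B = -192/115`, `a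 = 192/115`, `T(a) = [5, 23]`: row `W6.3.115` (NON-split); `r₁ = dim_K H¹(D)_λ = 1`, `r_H = 7`. THEOREM S8 (Prym form of the product-window law, census b04.15 (A): `[a_B] = [n]^{r₁}`, no 2-transitivity needed) predicts `T(a_B) = [5, 23]` from `r₁ = 1`, `n = 115` — CONFIRMED.
research route conditional on HC_CM; not a corollary; Q11.4-sentence-2 already refuted in dim ≥ 3. [cite: vanGeemen1994HodgeAV, (5.4.1)] -/
theorem pillow3_C3A115_n115_349df0_mk_detH_ne_split :
    (QuotientGroup.mk (Units.mk0 (((-192 : ℚ) / 115)) (by norm_num)) : weilNormResidueGroup 3) ≠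
      splitDiscriminantClass 3 3 := by
  have e : Units.mk0 (((-192 : ℚ) / 115)) (by norm_num) = -(Units.mk0 ((192 : ℚ) / 115) (by norm_num)) := Units.ext (by norm_num)
  rw [Ne, e, mk_neg_eq_splitDiscriminantClass_iff_of_odd (n := 3) (by decide)]
  have h := mul_not_mem_normUnitsSubgroup (mem_normUnitsSubgroup_of_sq_add_mul_sq (d := 3) (a := ((192 : ℚ) / 13225)) (by norm_num) (0 : ℚ) ((8 : ℚ) / 115) (by norm_num))
    SqrtNeg3.not_mem_115
  rw [mk0_mul_mk0] at h
  norm_num at h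
  exact h

/-- The same datum, CELL IDENTIFICATION: `[det H|_B] = [-115]` in `ℚˣ/Nm(ℚ(√-3)ˣ)` — the census ROW KEY of `W6.3.115` (`a·115 = (192 : ℚ) = ((0 : ℚ))² + 3·((8 : ℚ))²`).
research route conditional on HC_CM; not a corollary; Q11.4-sentence-2 already refuted in dim ≥ 3. [cite: vanGeemen1994HodgeAV, Lemma 5.2 (3)] -/
theorem pillow3_C3A115_n115_349df0_mk_detH_eq_key :
    (QuotientGroup.mk (Units.mk0 (-(((192 : ℚ) / 115))) (neg_ne_zero.2 (by norm_num))) : weilNormResidueGroup 3) =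
      QuotientGroup.mk (Units.mk0 (-(115 : ℚ)) (neg_ne_zero.2 (by norm_num))) :=
  mk_neg_eq_mk_neg_of_mul_mem (by norm_num) (by norm_num)
    (mem_normUnitsSubgroup_of_sq_add_mul_sq _ (0 : ℚ) (8 : ℚ) (by norm_num))

/-- PILLOWCASE datum (A₂ alcove lattice, orbifold `ℙ¹(3,3,3) = E_ω/C₃`): the double of the lattice 9-gon `P` with turning sequence `-1,-1,-1,+2,+1,+1,+1,+2,+2` (×60°) and side lengths `1,1,1,89,1,89,2,3,2` is a Belyi map `φ_P : ℙ¹ → ℙ¹` of degree `n = 187` (= number of alcoves of `P`) with passport `(4.3^60.2.1, 4^2.3^58.2^2.1, 3^62.1)` and monodromy group `A187` (certified: randomized Schreier–Sims lower bound = the full order); `Y_P : y³ = φ_P(φ_P − 1)` (genus 7) is the normalised fibre product `E ×_{ℙ¹} ℙ¹_{φ_P}` (561 sheets over `ℙ¹`; engine `bigwin.py`, exact) and the HIDDEN FACTOR `B` = the `λ`-part of the Prym `P(Y_P/E)` — an abelian SIXFOLD with `(3,3)` `ℚ(√-3)`-action, WEIL TYPE — has literal `det H|_B = -192/187`, `a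 = 192/187`, `T(a) = [11, 17]`: row `W6.3.187` (NON-split); `r₁ = dim_K H¹(D)_λ = 1`, `r_H = 7`. THEOREM S8 (Prym form of the product-window law, census b04.15 (A): `[a_B] = [n]^{r₁}`, no 2-transitivity needed) predicts `T(a_B) = [11, 17]` from `r₁ = 1`, `n = 187` — CONFIRMED.
research route conditional on HC_CM; not a corollary; Q11.4-sentence-2 already refuted in dim ≥ 3. [cite: vanGeemen1994HodgeAV, (5.4.1)] -/
theorem pillow3_C3A187_n187_e4460b_mk_detH_ne_split :
    (QuotientGroup.mk (Units.mk0 (((-192 : ℚ) / 187)) (by norm_num)) : weilNormResidueGroup 3) ≠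
      splitDiscriminantClass 3 3 := by
  have e : Units.mk0 (((-192 : ℚ) / 187)) (by norm_num) = -(Units.mk0 ((192 : ℚ) / 187) (by norm_num)) := Units.ext (by norm_num)
  rw [Ne, e, mk_neg_eq_splitDiscriminantClass_iff_of_odd (n := 3) (by decide)]
  have h := mul_not_mem_normUnitsSubgroup (mem_normUnitsSubgroup_of_sq_add_mul_sq (d := 3) (a := ((192 : ℚ) / 34969)) (by norm_num) (0 : ℚ) ((8 : ℚ) / 187) (by norm_num))
    Summit.HodgeConjecture.HodgeConjecture.Ring2.WeilCoverage.SqrtNeg3.not_mem_187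
  rw [mk0_mul_mk0] at h
  norm_num at h
  exact h

/-- The same datum, CELL IDENTIFICATION: `[det H|_B] = [-187]` in `ℚˣ/Nm(ℚ(√-3)ˣ)` — the census ROW KEY of `W6.3.187` (`a·187 = (192 : ℚ) = ((0 : ℚ))² + 3·((8 : ℚ))²`).
research route conditional on HC_CM; not a corollary; Q11.4-sentence-2 already refuted in dim ≥ 3. [cite: vanGeemen1994HodgeAV, Lemma 5.2 (3)] -/
theorem pillow3_C3A187_n187_e4460b_mk_detH_eq_key :
    (QuotientGroup.mk (Units.mk0 (-(((192 : ℚ) / 187))) (neg_ne_zero.2 (by norm_num))) : weilNormResidueGroup 3) =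
      QuotientGroup.mk (Units.mk0 (-(187 : ℚ)) (neg_ne_zero.2 (by norm_num))) :=
  mk_neg_eq_mk_neg_of_mul_mem (by norm_num) (by norm_num)
    (mem_normUnitsSubgroup_of_sq_add_mul_sq _ (0 : ℚ) (8 : ℚ) (by norm_num))

/-! ### §2 `K = ℚ(i)`: `n = 57, 69, 77, 133, 161` -/

/-- PILLOWCASE datum (B₂ alcove lattice, orbifold `ℙ¹(4,4,2) = E_i/C₄`): the double of the lattice 9-gon `P` with turning sequence `-2,+1,+3,-2,+2,+2,-1,+2,+3` (×45°) and side lengths `1,1,1,1,26,1,26,1,1` is a Belyi map `φ_P : ℙ¹ → ℙ¹` of degree `n = 57` (= number of alcoves of `P`) with passport `(5.4^12.2.1^2, 4^13.3.2, 3^2.2^25.1)` and monodromy group `S57` (certified: randomized Schreier–Sims lower bound = the full order); `Y_P : y⁴ = φ_P(φ_P − 1)` (genus 8) is the normalised fibre product `E ×_{ℙ¹} ℙ¹_{φ_P}` (228 sheets over `ℙ¹`; engine `bigwin.py`, exact) and the HIDDEN FACTOR `B` = the `λ`-part of the Prym `P(Y_P/E)` — an abelian SIXFOLD with `(3,3)`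 `ℚ(√-1)`-action, WEIL TYPE — has literal `det H|_B = -2/57`, `a = 2/57`, `T(a) = [3, 19]`: row `W6.1.57` (NON-split); `r₁ = dim_K H¹(D)_λ = 1`, `r_H = 7`. THEOREM S8 (Prym form of the product-window law, census b04.15 (A): `[a_B] = [n]^{r₁}`, no 2-transitivity needed) predicts `T(a_B) = [3, 19]` from `r₁ = 1`, `n = 57` — CONFIRMED.
research route conditional on HC_CM; not a corollary; Q11.4-sentence-2 already refuted in dim ≥ 3. [cite: vanGeemen1994HodgeAV, (5.4.1)] -/
theorem pillow4_C4S57_n57_fda128_mk_detH_ne_split :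
    (QuotientGroup.mk (Units.mk0 (((-2 : ℚ) / 57)) (by norm_num)) : weilNormResidueGroup 1) ≠
      splitDiscriminantClass 3 1 := by
  have e : Units.mk0 (((-2 : ℚ) / 57)) (by norm_num) = -(Units.mk0 ((2 : ℚ) / 57) (by norm_num)) := Units.ext (by norm_num)
  rw [Ne, e, mk_neg_eq_splitDiscriminantClass_iff_of_odd (n := 3) (by decide)]
  have h := mul_not_mem_normUnitsSubgroup (mem_normUnitsSubgroup_of_sq_add_mul_sq (d := 1) (a := ((2 : ℚ) / 3249)) (by norm_num) ((1 : ℚ) / 57) ((1 : ℚ) / 57) (by norm_num))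
    Summit.HodgeConjecture.HodgeConjecture.Ring2.WeilCoverage.SqrtNeg1.not_mem_57
  rw [mk0_mul_mk0] at h
  norm_num at h
  exact h

/-- The same datum, CELL IDENTIFICATION: `[det H|_B] = [-57]` in `ℚˣ/Nm(ℚ(√-1)ˣ)` — the census ROW KEY of `W6.1.57` (`a·57 = (2 : ℚ) = ((1 : ℚ))² + 1·((1 : ℚ))²`).
research route conditional on HC_CM; not a corollary; Q11.4-sentence-2 already refuted in dim ≥ 3. [cite: vanGeemen1994HodgeAV, Lemma 5.2 (3)] -/
theorem pillow4_C4S57_n57_fda128_mk_detH_eq_key :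
    (QuotientGroup.mk (Units.mk0 (-(((2 : ℚ) / 57))) (neg_ne_zero.2 (by norm_num))) : weilNormResidueGroup 1) =
      QuotientGroup.mk (Units.mk0 (-(57 : ℚ)) (neg_ne_zero.2 (by norm_num))) :=
  mk_neg_eq_mk_neg_of_mul_mem (by norm_num) (by norm_num)
    (mem_normUnitsSubgroup_of_sq_add_mul_sq _ (1 : ℚ) (1 : ℚ) (by norm_num))

/-- PILLOWCASE datum (B₂ alcove lattice, orbifold `ℙ¹(4,4,2) = E_i/C₄`): the double of the lattice 9-gon `P` with turning sequence `-2,+1,+3,-2,+2,+2,-1,+2,+3` (×45°) and side lengths `1,1,1,1,32,1,32,1,1` is a Belyi map `φ_P : ℙ¹ → ℙ¹` of degree `n = 69` (= number of alcoves of `P`) with passport `(5.4^15.2.1^2, 4^16.3.2, 3^2.2^31.1)` and monodromy group `S69` (certified: randomized Schreier–Sims lower bound = the full order); `Y_P : y⁴ = φ_P(φ_P − 1)` (genus 8) is the normalised fibre product `E ×_{ℙ¹} ℙ¹_{φ_P}` (276 sheets over `ℙ¹`; engine `bigwin.py`, exact) and the HIDDEN FACTOR `B` = the `λ`-part of the Prym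 `P(Y_P/E)` — an abelian SIXFOLD with `(3,3)` `ℚ(√-1)`-action, WEIL TYPE — has literal `det H|_B = -2/69`, `a = 2/69`, `T(a) = [3, 23]`: row `W6.1.69` (NON-split); `r₁ = dim_K H¹(D)_λ = 1`, `r_H = 7`. THEOREM S8 (Prym form of the product-window law, census b04.15 (A): `[a_B] = [n]^{r₁}`, no 2-transitivity needed) predicts `T(a_B) = [3, 23]` from `r₁ = 1`, `n = 69` — CONFIRMED.
research route conditional on HC_CM; not a corollary; Q11.4-sentence-2 already refuted in dim ≥ 3. [cite: vanGeemen1994HodgeAV, (5.4.1)] -/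
theorem pillow4_C4S69_n69_88ce8a_mk_detH_ne_split :
    (QuotientGroup.mk (Units.mk0 (((-2 : ℚ) / 69)) (by norm_num)) : weilNormResidueGroup 1) ≠
      splitDiscriminantClass 3 1 := by
  have e : Units.mk0 (((-2 : ℚ) / 69)) (by norm_num) = -(Units.mk0 ((2 : ℚ) / 69) (by norm_num)) := Units.ext (by norm_num)
  rw [Ne, e, mk_neg_eq_splitDiscriminantClass_iff_of_odd (n := 3) (by decide)]
  have h := mul_not_mem_normUnitsSubgroup (mem_normUnitsSubgroup_of_sq_add_mul_sq (d := 1) (a := ((2 : ℚ) / 4761)) (by norm_num) ((1 : ℚ) / 69) ((1 : ℚ) / 69) (by norm_num))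
    SqrtNeg1.not_mem_69
  rw [mk0_mul_mk0] at h
  norm_num at h
  exact h

/-- The same datum, CELL IDENTIFICATION: `[det H|_B] = [-69]` in `ℚˣ/Nm(ℚ(√-1)ˣ)` — the census ROW KEY of `W6.1.69` (`a·69 = (2 : ℚ) = ((1 : ℚ))² + 1·((1 : ℚ))²`).
research route conditional on HC_CM; not a corollary; Q11.4-sentence-2 already refuted in dim ≥ 3. [cite: vanGeemen1994HodgeAV, Lemma 5.2 (3)] -/
theorem pillow4_C4S69_n69_88ce8a_mk_detH_eq_key :
    (QuotientGroup.mk (Units.mk0 (-(((2 : ℚ) / 69))) (neg_ne_zero.2 (by norm_num))) : weilNormResidueGroup 1) =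
      QuotientGroup.mk (Units.mk0 (-(69 : ℚ)) (neg_ne_zero.2 (by norm_num))) :=
  mk_neg_eq_mk_neg_of_mul_mem (by norm_num) (by norm_num)
    (mem_normUnitsSubgroup_of_sq_add_mul_sq _ (1 : ℚ) (1 : ℚ) (by norm_num))

/-- PILLOWCASE datum (B₂ alcove lattice, orbifold `ℙ¹(4,4,2) = E_i/C₄`): the double of the lattice 9-gon `P` with turning sequence `-2,+1,+3,-2,+2,+2,-1,+2,+3` (×45°) and side lengths `1,1,1,1,36,1,36,1,1` is a Belyi map `φ_P : ℙ¹ → ℙ¹` of degree `n = 77` (= number of alcoves of `P`) with passport `(5.4^17.2.1^2, 4^18.3.2, 3^2.2^35.1)` and monodromy group `S77` (certified: randomized Schreier–Sims lower bound = the full order); `Y_P : y⁴ = φ_P(φ_P − 1)` (genus 8) is the normalised fibre product `E ×_{ℙ¹} ℙ¹_{φ_P}` (308 sheets over `ℙ¹`; engine `bigwin.py`, exact) and the HIDDEN FACTOR `B` = the `λ`-part of the Prym `P(Y_P/E)` — an abelian SIXFOLD with `(3,3)` `ℚ(√-1)`-action, WEIL TYPE — has literal `det H|_B = -2/77`, `a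 = 2/77`, `T(a) = [7, 11]`: row `W6.1.77` (NON-split); `r₁ = dim_K H¹(D)_λ = 1`, `r_H = 7`. THEOREM S8 (Prym form of the product-window law, census b04.15 (A): `[a_B] = [n]^{r₁}`, no 2-transitivity needed) predicts `T(a_B) = [7, 11]` from `r₁ = 1`, `n = 77` — CONFIRMED.
research route conditional on HC_CM; not a corollary; Q11.4-sentence-2 already refuted in dim ≥ 3. [cite: vanGeemen1994HodgeAV, (5.4.1)] -/
theorem pillow4_C4S77_n77_524425_mk_detH_ne_split :
    (QuotientGroup.mk (Units.mk0 (((-2 : ℚ) / 77)) (by norm_num)) : weilNormResidueGroup 1) ≠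
      splitDiscriminantClass 3 1 := by
  have e : Units.mk0 (((-2 : ℚ) / 77)) (by norm_num) = -(Units.mk0 ((2 : ℚ) / 77) (by norm_num)) := Units.ext (by norm_num)
  rw [Ne, e, mk_neg_eq_splitDiscriminantClass_iff_of_odd (n := 3) (by decide)]
  have h := mul_not_mem_normUnitsSubgroup (mem_normUnitsSubgroup_of_sq_add_mul_sq (d := 1) (a := ((2 : ℚ) / 5929)) (by norm_num) ((1 : ℚ) / 77) ((1 : ℚ) / 77) (by norm_num))
    Summit.HodgeConjecture.HodgeConjecture.Ring2.WeilCoverage.SqrtNeg1.not_mem_77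
  rw [mk0_mul_mk0] at h
  norm_num at h
  exact h

/-- The same datum, CELL IDENTIFICATION: `[det H|_B] = [-77]` in `ℚˣ/Nm(ℚ(√-1)ˣ)` — the census ROW KEY of `W6.1.77` (`a·77 = (2 : ℚ) = ((1 : ℚ))² + 1·((1 : ℚ))²`).
research route conditional on HC_CM; not a corollary; Q11.4-sentence-2 already refuted in dim ≥ 3. [cite: vanGeemen1994HodgeAV, Lemma 5.2 (3)] -/
theorem pillow4_C4S77_n77_524425_mk_detH_eq_key :
    (QuotientGroup.mk (Units.mk0 (-(((2 : ℚ) / 77))) (neg_ne_zero.2 (by norm_num))) : weilNormResidueGroup 1) =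
      QuotientGroup.mk (Units.mk0 (-(77 : ℚ)) (neg_ne_zero.2 (by norm_num))) :=
  mk_neg_eq_mk_neg_of_mul_mem (by norm_num) (by norm_num)
    (mem_normUnitsSubgroup_of_sq_add_mul_sq _ (1 : ℚ) (1 : ℚ) (by norm_num))

/-- PILLOWCASE datum (B₂ alcove lattice, orbifold `ℙ¹(4,4,2) = E_i/C₄`): the double of the lattice 9-gon `P` with turning sequence `-2,+1,+3,-2,+2,+2,-1,+2,+3` (×45°) and side lengths `1,1,1,1,64,1,64,1,1` is a Belyi map `φ_P : ℙ¹ → ℙ¹` of degree `n = 133` (= number of alcoves of `P`) with passport `(5.4^31.2.1^2, 4^32.3.2, 3^2.2^63.1)` and monodromy group `S133` (certified: randomized Schreier–Sims lower bound = the full order); `Y_P : y⁴ = φ_P(φ_P − 1)` (genus 8) is the normalised fibre product `E ×_{ℙ¹} ℙ¹_{φ_P}` (532 sheets over `ℙ¹`; engine `bigwin.py`, exact) and the HIDDEN FACTOR `B` = the `λ`-part of the Prym `P(Y_P/E)` — an abelian SIXFOLD with `(3,3)` `ℚ(√-1)`-action, WEIL TYPE — has literal `det H|_B = -2/133`, `a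 = 2/133`, `T(a) = [7, 19]`: row `W6.1.133` (NON-split); `r₁ = dim_K H¹(D)_λ = 1`, `r_H = 7`. THEOREM S8 (Prym form of the product-window law, census b04.15 (A): `[a_B] = [n]^{r₁}`, no 2-transitivity needed) predicts `T(a_B) = [7, 19]` from `r₁ = 1`, `n = 133` — CONFIRMED.
research route conditional on HC_CM; not a corollary; Q11.4-sentence-2 already refuted in dim ≥ 3. [cite: vanGeemen1994HodgeAV, (5.4.1)] -/
theorem pillow4_C4S133_n133_c3898d_mk_detH_ne_split :
    (QuotientGroup.mk (Units.mk0 (((-2 : ℚ) / 133)) (by norm_num)) : weilNormResidueGroup 1) ≠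
      splitDiscriminantClass 3 1 := by
  have e : Units.mk0 (((-2 : ℚ) / 133)) (by norm_num) = -(Units.mk0 ((2 : ℚ) / 133) (by norm_num)) := Units.ext (by norm_num)
  rw [Ne, e, mk_neg_eq_splitDiscriminantClass_iff_of_odd (n := 3) (by decide)]
  have h := mul_not_mem_normUnitsSubgroup (mem_normUnitsSubgroup_of_sq_add_mul_sq (d := 1) (a := ((2 : ℚ) / 17689)) (by norm_num) ((1 : ℚ) / 133) ((1 : ℚ) / 133) (by norm_num))
    Summit.HodgeConjecture.HodgeConjecture.Ring2.WeilCoverage.SqrtNeg1.not_mem_133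
  rw [mk0_mul_mk0] at h
  norm_num at h
  exact h

/-- The same datum, CELL IDENTIFICATION: `[det H|_B] = [-133]` in `ℚˣ/Nm(ℚ(√-1)ˣ)` — the census ROW KEY of `W6.1.133` (`a·133 = (2 : ℚ) = ((1 : ℚ))² + 1·((1 : ℚ))²`).
research route conditional on HC_CM; not a corollary; Q11.4-sentence-2 already refuted in dim ≥ 3. [cite: vanGeemen1994HodgeAV, Lemma 5.2 (3)] -/
theorem pillow4_C4S133_n133_c3898d_mk_detH_eq_key :
    (QuotientGroup.mk (Units.mk0 (-(((2 : ℚ) / 133))) (neg_ne_zero.2 (by norm_num))) : weilNormResidueGroup 1) =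
      QuotientGroup.mk (Units.mk0 (-(133 : ℚ)) (neg_ne_zero.2 (by norm_num))) :=
  mk_neg_eq_mk_neg_of_mul_mem (by norm_num) (by norm_num)
    (mem_normUnitsSubgroup_of_sq_add_mul_sq _ (1 : ℚ) (1 : ℚ) (by norm_num))

/-- PILLOWCASE datum (B₂ alcove lattice, orbifold `ℙ¹(4,4,2) = E_i/C₄`): the double of the lattice 9-gon `P` with turning sequence `-2,+1,+3,-2,+2,+2,-1,+2,+3` (×45°) and side lengths `1,1,1,1,78,1,78,1,1` is a Belyi map `φ_P : ℙ¹ → ℙ¹` of degree `n = 161` (= number of alcoves of `P`) with passport `(5.4^38.2.1^2, 4^39.3.2, 3^2.2^77.1)` and monodromy group `S161` (certified: randomized Schreier–Sims lower bound = the full order); `Y_P : y⁴ = φ_P(φ_P − 1)` (genus 8) is the normalised fibre product `E ×_{ℙ¹} ℙ¹_{φ_P}` (644 sheets over `ℙ¹`; engine `bigwin.py`, exact) and the HIDDEN FACTOR `B` = the `λ`-part of the Prym `P(Y_P/E)` — an abelian SIXFOLD with `(3,3)` `ℚ(√-1)`-action, WEIL TYPE — has literal `det H|_B = -2/161`, `a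 = 2/161`, `T(a) = [7, 23]`: row `W6.1.161` (NON-split); `r₁ = dim_K H¹(D)_λ = 1`, `r_H = 7`. THEOREM S8 (Prym form of the product-window law, census b04.15 (A): `[a_B] = [n]^{r₁}`, no 2-transitivity needed) predicts `T(a_B) = [7, 23]` from `r₁ = 1`, `n = 161` — CONFIRMED.
research route conditional on HC_CM; not a corollary; Q11.4-sentence-2 already refuted in dim ≥ 3. [cite: vanGeemen1994HodgeAV, (5.4.1)] -/
theorem pillow4_C4S161_n161_c73d35_mk_detH_ne_split :
    (QuotientGroup.mk (Units.mk0 (((-2 : ℚ) / 161)) (by norm_num)) : weilNormResidueGroup 1) ≠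
      splitDiscriminantClass 3 1 := by
  have e : Units.mk0 (((-2 : ℚ) / 161)) (by norm_num) = -(Units.mk0 ((2 : ℚ) / 161) (by norm_num)) := Units.ext (by norm_num)
  rw [Ne, e, mk_neg_eq_splitDiscriminantClass_iff_of_odd (n := 3) (by decide)]
  have h := mul_not_mem_normUnitsSubgroup (mem_normUnitsSubgroup_of_sq_add_mul_sq (d := 1) (a := ((2 : ℚ) / 25921)) (by norm_num) ((1 : ℚ) / 161) ((1 : ℚ) / 161) (by norm_num))
    SqrtNeg1.not_mem_161
  rw [mk0_mul_mk0] at h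
  norm_num at h
  exact h

/-- The same datum, CELL IDENTIFICATION: `[det H|_B] = [-161]` in `ℚˣ/Nm(ℚ(√-1)ˣ)` — the census ROW KEY of `W6.1.161` (`a·161 = (2 : ℚ) = ((1 : ℚ))² + 1·((1 : ℚ))²`).
research route conditional on HC_CM; not a corollary; Q11.4-sentence-2 already refuted in dim ≥ 3. [cite: vanGeemen1994HodgeAV, Lemma 5.2 (3)] -/
theorem pillow4_C4S161_n161_c73d35_mk_detH_eq_key :
    (QuotientGroup.mk (Units.mk0 (-(((2 : ℚ) / 161))) (neg_ne_zero.2 (by norm_num))) : weilNormResidueGroup 1) =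
      QuotientGroup.mk (Units.mk0 (-(161 : ℚ)) (neg_ne_zero.2 (by norm_num))) :=
  mk_neg_eq_mk_neg_of_mul_mem (by norm_num) (by norm_num)
    (mem_normUnitsSubgroup_of_sq_add_mul_sq _ (1 : ℚ) (1 : ℚ) (by norm_num))

end Summit.HodgeConjecture.HodgeConjecture.Ring2.WeilCoverage
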